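import Mathlib
import Literature.RingTheory.CohomologyAnnihilator.Basic
import Summits.ResolutionOfSingularities.ResolutionOfSingularities.Theorems.HomologicalConductorPersistenceNrmAdjoinInv
import Summits.ResolutionOfSingularities.ResolutionOfSingularities.Theorems.HomologicalConductorPersistenceLocalisation
import Summits.ResolutionOfSingularities.ResolutionOfSingularities.Theorems.HomologicalConductorPersistenceExistsMinimal
import Summits.ResolutionOfSingularities.ResolutionOfSingularities.Theorems.HomologicalConductorPersistenceAffineChartEssFiniteType
import Summits.ResolutionOfSingularities.ResolutionOfSingularities.Theorems.HomologicalConductorPersistenceNormalisedChartRegular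
import Summits.ResolutionOfSingularities.ResolutionOfSingularities.Theorems.SyzygyFlatteningHigherRankTerminationLocAt
import Summits.ResolutionOfSingularities.ResolutionOfSingularities.Theorems.SyzygyFlatteningHigherRankTerminationTowerStageBasic
import Summits.ResolutionOfSingularities.ResolutionOfSingularities.Theorems.SyzygyFlatteningHigherRankTerminationEssFiniteType
import HarnessLib

/-!
# The tower step in LOCAL form: `T_(m+1) = loc (nrm (B[ca B / x₀]))`, and persistence from one local membership

Crux `HomologicalConductor.Persistence` (stmt-ResolutionOfSingularities-16484), line `birth`
(reshape 3). One step of the canonical tower is `T_(m+1) = loc (nrm (chart T_m))`, where the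
route's `chart B = k[B ∪ {c * x⁻¹ | c, x ∈ ca B, x ≠ 0 of minimal O-value}]` adjoins the ratios
over ALL elements of minimal value. Helpers landed here (`[OURS · L1 w44b]`, folklore bookkeeping;
not statements of any manuscript):

* `locAt_adjoin_union_inv_eq` — **localisation at the centre absorbs inverted `O`-units**: for
  `D ⊆ O` and `T ⊆ D` with `t⁻¹ ∈ O` for all `t ∈ T`, `loc (D[T⁻¹]) = loc D`
  (tree `locAt_locAt`, [NovacoskiSpivakovsky2014, Lemma 2.5]).
* `chart_eq_adjoin_affChart_inv` — the route's chart is `B'[T⁻¹]` for the ONE affine chart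
  `B' = B[ca B / x₀]` (`x₀` any element of minimal value) and the `O`-units
  `T = {x * x₀⁻¹ | x of minimal value}` (re-proof, in tree vocabulary, of the skeleton's
  `chartWith_caK_eq_adjoin_inv`).
* `locAt_nrm_chart_eq` — hence **`loc (nrm (chart B)) = loc (nrm (B[ca B / x₀]))`**: the tower
  step is the normalised affine chart localised at the centre (normalisation commutes with
  adjoining inverses, landed `nrm_adjoin_union_inv`, [StacksProject, Tag 0307]).
* `image_subset_image_step_of_mem_locAt` — so the step `ca B ⊆ ca (loc (nrm (chart B)))` follows
  from the ONE LOCAL membership `x₀ ∈ ca (loc (nrm (B[ca B / x₀])))` (landed reduction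
  `image_subset_image_of_mem`); `step_of_local_core` packages the degenerate case `ca B = 0` and
  the existence of an element of minimal value (landed `stub_exists_minimal`), so that a line may
  take as its core stub the LOCAL statement at the centre — weaker than the registered global
  stub `stub_normalisedChartPersistence`, which implies it (`mem_locAt_of_mem_nrm`, by the landed
  localisation persistence [IyengarTakahashi2014, Lemma 2.10 (1)]).

References: S. B. Iyengar, R. Takahashi, *Annihilation of cohomology and strong generation of
module categories*, IMRN 2016 [`IyengarTakahashi2014`]; J. Novacoski, M. Spivakovsky,
*Reduction of local uniformization to the rank one case* [`NovacoskiSpivakovsky2014`];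
The Stacks Project, Tag 0307 [`StacksProject`].
-/

-- single-problem summit: the doubled namespace component is forced
set_option linter.dupNamespace false

noncomputable section

namespace Summit.ResolutionOfSingularities.ResolutionOfSingularities.Theorems.HomologicalConductor.PersistenceLocalStep

open Literature.RingTheory.CohomologyAnnihilator
open Summit.ResolutionOfSingularities.ResolutionOfSingularities.Theorems.SyzygyFlattening
  (nrm locAt self_le_nrm self_le_locAt nrm_toSubring_le adjoin_toSubring_le_valuationSubring
    locAt_mono locAt_locAt mul_inv_mem_locAt stub_essFiniteType_nrm)
open Summit.ResolutionOfSingularities.ResolutionOfSingularities.Theorems.HomologicalConductor.PersistenceNrmAdjoinInv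
  (nrm_adjoin_union_inv)
open Summit.ResolutionOfSingularities.ResolutionOfSingularities.Theorems.HomologicalConductor.PersistenceInversion
  (le_adjoin_union_inv)
open Summit.ResolutionOfSingularities.ResolutionOfSingularities.Theorems.HomologicalConductor.PersistenceLocalisation
  (stub_localisationPersistence)
open Summit.ResolutionOfSingularities.ResolutionOfSingularities.Theorems.HomologicalConductor.PersistenceExistsMinimal
  (stub_exists_minimal)
open Summit.ResolutionOfSingularities.ResolutionOfSingularities.Theorems.HomologicalConductor.PersistenceAffineChartEssFiniteType
  (stub_affineChartEssFiniteType)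
open Summit.ResolutionOfSingularities.ResolutionOfSingularities.Theorems.HomologicalConductor.PersistenceNormalisedChartRegular
  (image_subset_image_of_mem)

variable {k K : Type} [Field k] [Field K] [Algebra k K]

/-! ## Localisation at the centre absorbs inverted `O`-units -/

/-- **`loc (D[T⁻¹]) = loc D`** for `D ⊆ O` and `T ⊆ D` consisting of `O`-units (`t⁻¹ ∈ O`):
every `t⁻¹ = 1 * t⁻¹` is already a generator of `loc D`, so `D[T⁻¹] ≤ loc D`, and `loc` is
monotone and idempotent on subalgebras of `O` (tree `locAt_locAt`).
[cite: NovacoskiSpivakovsky2014, Lemma 2.5] -/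
theorem locAt_adjoin_union_inv_eq (O : ValuationSubring K) (D : Subalgebra k K)
    (hD : D.toSubring ≤ O.toSubring) (T : Set K) (hT : T ⊆ ↑D) (hTO : ∀ t ∈ T, t⁻¹ ∈ O) :
    locAt O (Algebra.adjoin k ((D : Set K) ∪ {y : K | ∃ t ∈ T, y = t⁻¹})) = locAt O D := by
  refine le_antisymm ?_ (locAt_mono O (le_adjoin_union_inv D T))
  have hle : Algebra.adjoin k ((D : Set K) ∪ {y : K | ∃ t ∈ T, y = t⁻¹}) ≤ locAt O D := by
    refine Algebra.adjoin_le ?_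
    rintro y (hy | ⟨t, ht, rfl⟩)
    · exact self_le_locAt O D hy
    · rw [← one_mul t⁻¹]
      exact mul_inv_mem_locAt O D (one_mem D) (hT ht) (hTO t ht)
  calc locAt O (Algebra.adjoin k ((D : Set K) ∪ {y : K | ∃ t ∈ T, y = t⁻¹}))
      ≤ locAt O (locAt O D) := locAt_mono O hle
    _ = locAt O D := locAt_locAt O D hD

/-! ## The route's chart is one affine chart with `O`-units inverted -/

/-- The affine chart `B[ca B / x₀]` lies in the route's chart as soon as `x₀ ∈ ca B` is a
nonzero element of minimal `O`-value. [folklore] -/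
theorem affChart_le_chart (O : ValuationSubring K) (B : Subalgebra k K) {x₀ : K}
    (hx₀ : x₀ ∈ (((↑) : ↥B → K) '' (cohomologyAnnihilator ↥B : Set ↥B))) (hx₀0 : x₀ ≠ 0)
    (hmin : ∀ c ∈ (((↑) : ↥B → K) '' (cohomologyAnnihilator ↥B : Set ↥B)), c * x₀⁻¹ ∈ O) :
    (Algebra.adjoin k ((B : Set K) ∪ {y : K | ∃ c ∈ (((↑) : ↥B → K) '' (cohomologyAnnihilator ↥B : Set ↥B)), y = c * x₀⁻¹})) ≤
      (Algebra.adjoin k ((B : Set K) ∪ {y : K | ∃ c ∈ (((↑) : ↥B → K) '' (cohomologyAnnihilator ↥B : Set ↥B)), ∃ x ∈ (((↑) : ↥B → K) '' (cohomologyAnnihilator ↥B : Set ↥B)),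
        x ≠ 0 ∧ (∀ c' ∈ (((↑) : ↥B → K) '' (cohomologyAnnihilator ↥B : Set ↥B)), c' * x⁻¹ ∈ O) ∧ y = c * x⁻¹})) := by
  refine Algebra.adjoin_le ?_
  rintro y (hy | ⟨c, hc, rfl⟩)
  · exact Algebra.subset_adjoin (Or.inl hy)
  · exact Algebra.subset_adjoin (Or.inr ⟨c, hc, x₀, hx₀, hx₀0, hmin, rfl⟩)

/-- **The route's chart is the affine chart with the `O`-units `x * x₀⁻¹` inverted**:
`chart B = (B[ca B / x₀])[(x * x₀⁻¹)⁻¹ | x ∈ ca B of minimal value]` for any `x₀ ∈ ca B` of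
minimal value — every generator `c * x⁻¹` equals `(c * x₀⁻¹) * (x * x₀⁻¹)⁻¹`, and conversely
`(x * x₀⁻¹)⁻¹ = x₀ * x⁻¹` is a generator of the chart. (Tree-vocabulary re-proof of the line
skeleton's `chartWith_caK_eq_adjoin_inv`.) [folklore] -/
theorem chart_eq_adjoin_affChart_inv (O : ValuationSubring K) (B : Subalgebra k K) {x₀ : K}
    (hx₀ : x₀ ∈ (((↑) : ↥B → K) '' (cohomologyAnnihilator ↥B : Set ↥B))) (hx₀0 : x₀ ≠ 0)
    (hmin : ∀ c ∈ (((↑) : ↥B → K) '' (cohomologyAnnihilator ↥B : Set ↥B)), c * x₀⁻¹ ∈ O) :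
    (Algebra.adjoin k ((B : Set K) ∪ {y : K | ∃ c ∈ (((↑) : ↥B → K) '' (cohomologyAnnihilator ↥B : Set ↥B)), ∃ x ∈ (((↑) : ↥B → K) '' (cohomologyAnnihilator ↥B : Set ↥B)),
        x ≠ 0 ∧ (∀ c' ∈ (((↑) : ↥B → K) '' (cohomologyAnnihilator ↥B : Set ↥B)), c' * x⁻¹ ∈ O) ∧ y = c * x⁻¹})) =
      Algebra.adjoin k (((Algebra.adjoin k ((B : Set K) ∪ {y : K | ∃ c ∈ (((↑) : ↥B → K) '' (cohomologyAnnihilator ↥B : Set ↥B)), y = c * x₀⁻¹})) : Set K) ∪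
        {y : K | ∃ t ∈ {t : K | ∃ x : K, (x ∈ (((↑) : ↥B → K) '' (cohomologyAnnihilator ↥B : Set ↥B)) ∧ x ≠ 0 ∧
        ∀ c ∈ (((↑) : ↥B → K) '' (cohomologyAnnihilator ↥B : Set ↥B)), c * x⁻¹ ∈ O) ∧ t = x * x₀⁻¹}, y = t⁻¹}) := by
  -- adapted from Cruxes/Persistence/Lines/birth.lean `chartWith_caK_eq_adjoin_inv` (lead gen 1)
  refine le_antisymm ?_ ?_
  · refine Algebra.adjoin_le ?_
    rintro y (hy | ⟨c, hc, x, hx, hx0, hxmin, rfl⟩)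
    · exact Algebra.subset_adjoin (Or.inl (Algebra.subset_adjoin (Or.inl hy)))
    · have hcx : c * x⁻¹ = (c * x₀⁻¹) * (x * x₀⁻¹)⁻¹ := by
        rw [mul_inv_rev, inv_inv, mul_assoc, ← mul_assoc x₀⁻¹, inv_mul_cancel₀ hx₀0, one_mul]
      rw [hcx]
      refine mul_mem ?_ ?_
      · exact Algebra.subset_adjoin (Or.inl (Algebra.subset_adjoin (Or.inr ⟨c, hc, rfl⟩)))
      · exact Algebra.subset_adjoin (Or.inr ⟨x * x₀⁻¹, ⟨x, ⟨hx, hx0, hxmin⟩, rfl⟩, rfl⟩)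
  · refine Algebra.adjoin_le ?_
    rintro y (hy | ⟨t, ⟨x, ⟨hx, hx0, hxmin⟩, rfl⟩, rfl⟩)
    · exact affChart_le_chart O B hx₀ hx₀0 hmin hy
    · have hinv : (x * x₀⁻¹)⁻¹ = x₀ * x⁻¹ := by rw [mul_inv_rev, inv_inv]
      rw [hinv]
      exact Algebra.subset_adjoin (Or.inr ⟨x₀, hx₀, x, hx, hx0, hxmin, rfl⟩)

/-- The ratios `x * x₀⁻¹` of elements of minimal value lie in the affine chart at `x₀`.
[folklore] -/
theorem ratioSet_subset_affChart (O : ValuationSubring K) (B : Subalgebra k K) (x₀ : K) :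
    {t : K | ∃ x : K, (x ∈ (((↑) : ↥B → K) '' (cohomologyAnnihilator ↥B : Set ↥B)) ∧ x ≠ 0 ∧
        ∀ c ∈ (((↑) : ↥B → K) '' (cohomologyAnnihilator ↥B : Set ↥B)), c * x⁻¹ ∈ O) ∧ t = x * x₀⁻¹} ⊆
      (↑(Algebra.adjoin k ((B : Set K) ∪ {y : K | ∃ c ∈ (((↑) : ↥B → K) '' (cohomologyAnnihilator ↥B : Set ↥B)), y = c * x₀⁻¹})) : Set K) := by
  rintro t ⟨x, ⟨hx, -, -⟩, rfl⟩
  exact Algebra.subset_adjoin (Or.inr ⟨x, hx, rfl⟩)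

/-- For `B ⊆ O` and `x₀` of minimal value, the affine chart `B[ca B / x₀]` lies in `O`.
[folklore] -/
theorem affChart_toSubring_le (O : ValuationSubring K) (B : Subalgebra k K)
    (hBO : B.toSubring ≤ O.toSubring) {x₀ : K}
    (hmin : ∀ c ∈ (((↑) : ↥B → K) '' (cohomologyAnnihilator ↥B : Set ↥B)), c * x₀⁻¹ ∈ O) :
    (Algebra.adjoin k ((B : Set K) ∪ {y : K | ∃ c ∈ (((↑) : ↥B → K) '' (cohomologyAnnihilator ↥B : Set ↥B)), y = c * x₀⁻¹})).toSubring ≤ O.toSubring := by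
  refine adjoin_toSubring_le_valuationSubring O (fun c => hBO (B.algebraMap_mem c)) ?_
  rintro y (hy | ⟨c, hc, rfl⟩)
  · exact hBO (Subalgebra.mem_toSubring.mpr hy)
  · exact hmin c hc

/-! ## The tower step in local form -/

/-- **`loc (nrm (chart B)) = loc (nrm (B[ca B / x₀]))`** for `B ⊆ O` and any `x₀ ∈ ca B` of
minimal `O`-value: `chart B = B'[T⁻¹]` with `B' = B[ca B / x₀]` and `T` a set of `O`-units of
`B'` (`chart_eq_adjoin_affChart_inv`), `nrm (B'[T⁻¹]) = (nrm B')[T⁻¹]` (landed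
`nrm_adjoin_union_inv`), and `loc ((nrm B')[T⁻¹]) = loc (nrm B')`
(`locAt_adjoin_union_inv_eq`, as `nrm B' ⊆ O`). So one step of the canonical tower is the
normalised affine `ca`-chart localised at the centre of `O`. [cite: StacksProject, Tag 0307] -/
theorem locAt_nrm_chart_eq (O : ValuationSubring K) (B : Subalgebra k K)
    (hBO : B.toSubring ≤ O.toSubring) {x₀ : K}
    (hx₀ : x₀ ∈ (((↑) : ↥B → K) '' (cohomologyAnnihilator ↥B : Set ↥B))) (hx₀0 : x₀ ≠ 0)
    (hmin : ∀ c ∈ (((↑) : ↥B → K) '' (cohomologyAnnihilator ↥B : Set ↥B)), c * x₀⁻¹ ∈ O) :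
    locAt O (nrm (Algebra.adjoin k ((B : Set K) ∪ {y : K | ∃ c ∈ (((↑) : ↥B → K) '' (cohomologyAnnihilator ↥B : Set ↥B)), ∃ x ∈ (((↑) : ↥B → K) '' (cohomologyAnnihilator ↥B : Set ↥B)),
        x ≠ 0 ∧ (∀ c' ∈ (((↑) : ↥B → K) '' (cohomologyAnnihilator ↥B : Set ↥B)), c' * x⁻¹ ∈ O) ∧ y = c * x⁻¹}))) =
      locAt O (nrm (Algebra.adjoin k ((B : Set K) ∪ {y : K | ∃ c ∈ (((↑) : ↥B → K) '' (cohomologyAnnihilator ↥B : Set ↥B)), y = c * x₀⁻¹}))) := by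
  have hT := ratioSet_subset_affChart O B x₀
  rw [chart_eq_adjoin_affChart_inv O B hx₀ hx₀0 hmin, nrm_adjoin_union_inv _ _ hT]
  have hk : ∀ c : k, algebraMap k K c ∈ O := fun c => hBO (B.algebraMap_mem c)
  refine locAt_adjoin_union_inv_eq O (nrm _) ?_ _ (fun t ht => self_le_nrm _ (hT ht)) ?_
  · exact nrm_toSubring_le O hk (affChart_toSubring_le O B hBO hmin)
  · rintro t ⟨x, ⟨-, -, hxmin⟩, rfl⟩
    rw [mul_inv_rev, inv_inv]
    exact hxmin x₀ hx₀

/-! ## Persistence along the step from ONE local membership -/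

/-- **The step from one local membership.** For `B ⊆ O` and `x₀ ∈ ca B` nonzero of minimal
`O`-value: if `x₀ ∈ ca (loc (nrm (B[ca B / x₀])))`, then `ca B ⊆ ca (loc (nrm (chart B)))`
(images in `K`) — by `locAt_nrm_chart_eq` and the landed reduction `image_subset_image_of_mem`
(`c = (c x₀⁻¹) · x₀`, `c x₀⁻¹ ∈ B[ca B / x₀] ⊆ loc (nrm (B[ca B / x₀]))`, `ca` an ideal).
[cite: IyengarTakahashi2014, Def. 2.1] -/
theorem image_subset_image_step_of_mem_locAt (O : ValuationSubring K) (B : Subalgebra k K)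
    (hBO : B.toSubring ≤ O.toSubring) {x₀ : K}
    (hx₀ : x₀ ∈ (((↑) : ↥B → K) '' (cohomologyAnnihilator ↥B : Set ↥B))) (hx₀0 : x₀ ≠ 0)
    (hmin : ∀ c ∈ (((↑) : ↥B → K) '' (cohomologyAnnihilator ↥B : Set ↥B)), c * x₀⁻¹ ∈ O)
    (hcore : x₀ ∈ (((↑) : ↥(locAt O (nrm (Algebra.adjoin k ((B : Set K) ∪ {y : K | ∃ c ∈ (((↑) : ↥B → K) '' (cohomologyAnnihilator ↥B : Set ↥B)), y = c * x₀⁻¹})))) → K) '' (cohomologyAnnihilator ↥(locAt O (nrm (Algebra.adjoin k ((B : Set K) ∪ {y : K | ∃ c ∈ (((↑) : ↥B → K) '' (cohomologyAnnihilator ↥B : Set ↥B)), y = c * x₀⁻¹})))) : Set _))) :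
    (((↑) : ↥B → K) '' (cohomologyAnnihilator ↥B : Set ↥B)) ⊆
      (((↑) : ↥(locAt O (nrm (Algebra.adjoin k ((B : Set K) ∪ {y : K | ∃ c ∈ (((↑) : ↥B → K) '' (cohomologyAnnihilator ↥B : Set ↥B)), ∃ x ∈ (((↑) : ↥B → K) '' (cohomologyAnnihilator ↥B : Set ↥B)),
        x ≠ 0 ∧ (∀ c' ∈ (((↑) : ↥B → K) '' (cohomologyAnnihilator ↥B : Set ↥B)), c' * x⁻¹ ∈ O) ∧ y = c * x⁻¹})))) → K) '' (cohomologyAnnihilator ↥(locAt O (nrm (Algebra.adjoin k ((B : Set K) ∪ {y : K | ∃ c ∈ (((↑) : ↥B → K) '' (cohomologyAnnihilator ↥B : Set ↥B)), ∃ x ∈ (((↑) : ↥B → K) '' (cohomologyAnnihilator ↥B : Set ↥B)),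
        x ≠ 0 ∧ (∀ c' ∈ (((↑) : ↥B → K) '' (cohomologyAnnihilator ↥B : Set ↥B)), c' * x⁻¹ ∈ O) ∧ y = c * x⁻¹})))) : Set _)) := by
  rw [locAt_nrm_chart_eq O B hBO hx₀ hx₀0 hmin]
  refine image_subset_image_of_mem B _ hx₀0 (fun c hc => ?_) hcore
  exact self_le_locAt O _ (self_le_nrm _ (Algebra.subset_adjoin (Or.inr ⟨c, hc, rfl⟩)))

/-- **One tower step from a LOCAL core.** For a noetherian `B ⊆ O`: if for every nonzero
`x₀ ∈ ca B` of minimal `O`-value the one membership `x₀ ∈ ca (loc (nrm (B[ca B / x₀])))` holds,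
then `ca B ⊆ ca (loc (nrm (chart B)))`. If `ca B = 0` the inclusion is `0 ∈ ca`; otherwise an
element of minimal value exists (landed `stub_exists_minimal`) and
`image_subset_image_step_of_mem_locAt` applies. This is the composition a line needs in order to
take the LOCAL membership at the centre as its core stub. [folklore] -/
theorem step_of_local_core (O : ValuationSubring K) (B : Subalgebra k K)
    (hBO : B.toSubring ≤ O.toSubring) (hB : IsNoetherianRing ↥B)
    (hcore : ∀ x₀ : K, x₀ ∈ (((↑) : ↥B → K) '' (cohomologyAnnihilator ↥B : Set ↥B)) → x₀ ≠ 0 →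
      (∀ c ∈ (((↑) : ↥B → K) '' (cohomologyAnnihilator ↥B : Set ↥B)), c * x₀⁻¹ ∈ O) →
      x₀ ∈ (((↑) : ↥(locAt O (nrm (Algebra.adjoin k ((B : Set K) ∪ {y : K | ∃ c ∈ (((↑) : ↥B → K) '' (cohomologyAnnihilator ↥B : Set ↥B)), y = c * x₀⁻¹})))) → K) '' (cohomologyAnnihilator ↥(locAt O (nrm (Algebra.adjoin k ((B : Set K) ∪ {y : K | ∃ c ∈ (((↑) : ↥B → K) '' (cohomologyAnnihilator ↥B : Set ↥B)), y = c * x₀⁻¹})))) : Set _))) :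
    (((↑) : ↥B → K) '' (cohomologyAnnihilator ↥B : Set ↥B)) ⊆
      (((↑) : ↥(locAt O (nrm (Algebra.adjoin k ((B : Set K) ∪ {y : K | ∃ c ∈ (((↑) : ↥B → K) '' (cohomologyAnnihilator ↥B : Set ↥B)), ∃ x ∈ (((↑) : ↥B → K) '' (cohomologyAnnihilator ↥B : Set ↥B)),
        x ≠ 0 ∧ (∀ c' ∈ (((↑) : ↥B → K) '' (cohomologyAnnihilator ↥B : Set ↥B)), c' * x⁻¹ ∈ O) ∧ y = c * x⁻¹})))) → K) '' (cohomologyAnnihilator ↥(locAt O (nrm (Algebra.adjoin k ((B : Set K) ∪ {y : K | ∃ c ∈ (((↑) : ↥B → K) '' (cohomologyAnnihilator ↥B : Set ↥B)), ∃ x ∈ (((↑) : ↥B → K) '' (cohomologyAnnihilator ↥B : Set ↥B)),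
        x ≠ 0 ∧ (∀ c' ∈ (((↑) : ↥B → K) '' (cohomologyAnnihilator ↥B : Set ↥B)), c' * x⁻¹ ∈ O) ∧ y = c * x⁻¹})))) : Set _)) := by
  haveI := hB
  by_cases h0 : ∃ c ∈ (((↑) : ↥B → K) '' (cohomologyAnnihilator ↥B : Set ↥B)), c ≠ 0
  · obtain ⟨c, ⟨c', hc', rfl⟩, hc0⟩ := h0
    have hI : cohomologyAnnihilator ↥B ≠ ⊥ := by
      intro hbot
      rw [hbot] at hc'
      exact hc0 (by rw [(Submodule.mem_bot ↥B).mp hc']; rfl)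
    obtain ⟨x, hxI, hx0, hxmin⟩ :=
      stub_exists_minimal k K O B hBO _ (IsNoetherian.noetherian _) hI
    have hx₀ : (x : K) ∈ (((↑) : ↥B → K) '' (cohomologyAnnihilator ↥B : Set ↥B)) := ⟨x, hxI, rfl⟩
    have hmin : ∀ c ∈ (((↑) : ↥B → K) '' (cohomologyAnnihilator ↥B : Set ↥B)), c * (x : K)⁻¹ ∈ O := by
      rintro c ⟨c'', hc'', rfl⟩
      exact hxmin c'' hc''
    exact image_subset_image_step_of_mem_locAt O B hBO hx₀ hx0 hmin (hcore x hx₀ hx0 hmin)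
  · push Not at h0
    intro c hc
    rw [h0 c hc]
    exact ⟨0, Ideal.zero_mem _, rfl⟩

/-! ## The registered (global) stub implies the local membership -/

/-- **Global ⇒ local.** For `B ⊆ O` essentially of finite type over `k` with `Frac B = K`, and
`x₀` with `c * x₀⁻¹ ∈ O` for `c ∈ ca B`: if `x₀ ∈ ca (nrm (B[ca B / x₀]))` (the registered stub's
membership) then `x₀ ∈ ca (loc (nrm (B[ca B / x₀])))` — the normalised chart is noetherian
(landed `stub_affineChartEssFiniteType`, tree `stub_essFiniteType_nrm`) and lies in `O`, so the
landed localisation persistence `stub_localisationPersistence` applies.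
[cite: IyengarTakahashi2014, Lemma 2.10 (1)] -/
theorem mem_locAt_of_mem_nrm (O : ValuationSubring K) (B : Subalgebra k K)
    (hBO : B.toSubring ≤ O.toSubring) [Algebra.EssFiniteType k ↥B] [IsFractionRing ↥B K]
    {x₀ : K} (hmin : ∀ c ∈ (((↑) : ↥B → K) '' (cohomologyAnnihilator ↥B : Set ↥B)), c * x₀⁻¹ ∈ O)
    (h : x₀ ∈ (((↑) : ↥(nrm (Algebra.adjoin k ((B : Set K) ∪ {y : K | ∃ c ∈ (((↑) : ↥B → K) '' (cohomologyAnnihilator ↥B : Set ↥B)), y = c * x₀⁻¹}))) → K) '' (cohomologyAnnihilator ↥(nrm (Algebra.adjoin k ((B : Set K) ∪ {y : K | ∃ c ∈ (((↑) : ↥B → K) '' (cohomologyAnnihilator ↥B : Set ↥B)), y = c * x₀⁻¹}))) : Set _))) :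
    x₀ ∈ (((↑) : ↥(locAt O (nrm (Algebra.adjoin k ((B : Set K) ∪ {y : K | ∃ c ∈ (((↑) : ↥B → K) '' (cohomologyAnnihilator ↥B : Set ↥B)), y = c * x₀⁻¹})))) → K) '' (cohomologyAnnihilator ↥(locAt O (nrm (Algebra.adjoin k ((B : Set K) ∪ {y : K | ∃ c ∈ (((↑) : ↥B → K) '' (cohomologyAnnihilator ↥B : Set ↥B)), y = c * x₀⁻¹})))) : Set _)) := by
  have hk : ∀ c : k, algebraMap k K c ∈ O := fun c => hBO (B.algebraMap_mem c)
  have hAO := affChart_toSubring_le O B hBO hmin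
  have hNO : (nrm (Algebra.adjoin k ((B : Set K) ∪ {y : K | ∃ c ∈ (((↑) : ↥B → K) '' (cohomologyAnnihilator ↥B : Set ↥B)), y = c * x₀⁻¹}))).toSubring ≤ O.toSubring := nrm_toSubring_le O hk hAO
  have hAft : Algebra.EssFiniteType k ↥(Algebra.adjoin k ((B : Set K) ∪ {y : K | ∃ c ∈ (((↑) : ↥B → K) '' (cohomologyAnnihilator ↥B : Set ↥B)), y = c * x₀⁻¹})) :=
    stub_affineChartEssFiniteType k K B x₀ inferInstance
  have hAfrac : IsFractionRing ↥(Algebra.adjoin k ((B : Set K) ∪ {y : K | ∃ c ∈ (((↑) : ↥B → K) '' (cohomologyAnnihilator ↥B : Set ↥B)), y = c * x₀⁻¹})) K :=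
    Literature.AlgebraicGeometry.Resolution.isFractionRing_subalgebra_of_le B _
      (fun y hy => Algebra.subset_adjoin (Or.inl hy))
  have hNft : Algebra.EssFiniteType k ↥(nrm (Algebra.adjoin k ((B : Set K) ∪ {y : K | ∃ c ∈ (((↑) : ↥B → K) '' (cohomologyAnnihilator ↥B : Set ↥B)), y = c * x₀⁻¹}))) := stub_essFiniteType_nrm k K _ hAfrac hAft
  have hNnoeth : IsNoetherianRing ↥(nrm (Algebra.adjoin k ((B : Set K) ∪ {y : K | ∃ c ∈ (((↑) : ↥B → K) '' (cohomologyAnnihilator ↥B : Set ↥B)), y = c * x₀⁻¹}))) :=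
    Algebra.EssFiniteType.isNoetherianRing k _
  exact stub_localisationPersistence k K O _ hNO hNnoeth h

end Summit.ResolutionOfSingularities.ResolutionOfSingularities.Theorems.HomologicalConductor.PersistenceLocalStep

end
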